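import Mathlib
import Summits.NavierStokesRegularity.FluidComputer.AbcInertiaExactlyOneTight
import Summits.NavierStokesRegularity.FluidComputer.AbcInertiaCIExactlyPair

/-!
# CONTEST-I AT `R = 300` AS ONE KERNEL SENTENCE: the class-I Hopf pair of the linearisation about the forced
# ABC flow lies STRICTLY TO THE RIGHT of the whole class-II point spectrum (instab3 g9, cell `ns-blowup`, 2026-08-27)

HONEST FRAMING (human rulings D-0035/D-0074): **MODEL linear operator, computer-assisted; not NS.** Nothing
here is a statement about Navier–Stokes regularity or blow-up. Object: the linearisation of forced NS about
`U = abcFlow 1 1 1` on the unit torus at viscosity `1/(2π·300)` (`R = 300` in certifier units), symmetry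
classes I (trivial character) and II (sign character) SEPARATELY; classes III–V are NOT treated (CLASS-TABLE
float says they trail at R 300; instab4 K3 is the symmetry-free certificate programme). bears_on LADDER-NS N1*
T6 («contest-I at R 300: which mode leads — the class-I Hopf pair or the class-II steady mode?») / profile W3.
WHAT THIS IS NOT: not NS; no certificate re-run; no number or census word moves; a kernel IMPLICATION whose
hypotheses are the finite-matrix facts four certificates print.

THE SENTENCE (`contestI_R300_i3`, implementation 1's INERTIA cells; `contestI_R300_i4`, implementation 2's):
GIVEN (T1) the 3-B-nested row `Row3002C` (class II) and (T2) the row `Row3001C` (class I) of profile-cert-3 in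
their classical-eigenpair forms (cert-3 g9), and the INERTIA-3L cells `(300, II, 1/5, 1)` and `(300, I, 43/200, 2)`
((R1) `𝓜 ≺ 0`, (R2) `GH + VVᵀ ≽ 0`; instab3 g7/g8, instab4 g8) — THEN: `σ_p(L_300|II) ∩ {Re ≥ 1/5} = {λ_II}`
with `λ_II` REAL, `|λ_II − 0.2617112187526| ≤ 5.1·10⁻¹²`; `σ_p(L_300|I) ∩ {Re ≥ 43/200} = {λ_I, conj λ_I}` with
`|λ_I − (0.2641917116223 + 0.6430289274262 i)| ≤ 7.5·10⁻¹²`, `Im λ_I > 0`; and **`Re z < Re λ_I` for EVERY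
classical class-II eigenpair `(z, u)`** (`γ_I(300) − γ_II(300) ≥ 0.0024804 > 0`). «Classical eigenpair» =
`Torus.LinNSResolventRel (1/(2π·300)) (abcFlow 1 1 1) (2πz) u 0`, `u ≠ 0`, with `IsClassII`/`IsClassI` Fourier
coefficients. Composition only: `AbcInertiaExactlyOneTight` ∘ `AbcInertiaCIExactlyPair` ∘ §1 below.

What is NOT kernel (referee list, unchanged): the rows' primary interval outputs and (R1)(R2) = the four
programs' verified arithmetic (referee re-runs / CHECK-ONLY jobs), AUDIT-BASIS (class-II INERTIA: any real
orthonormal orbit bases `e`; class-I INERTIA: the tree's bases `AbcClassI.bfam`; rows: any admissible complex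
orbit bases), and the restriction to classes I/II.

Mathlib + the two files named; no new definitions; std axioms. [folklore]
-/

noncomputable section

open scoped BigOperators ComplexConjugate InnerProductSpace Matrix
open Finset Matrix MeasureTheory UnitAddTorus

namespace Summit.NavierStokesRegularity.FluidComputer.AbcContestI

open Literature.Analysis.FunctionSpaces Literature.Analysis.FunctionSpaces.Torus
open Literature.Analysis.FunctionSpaces.EuclideanSpace
open Literature.Analysis.FluidPDE Literature.Analysis.FluidPDE.SteadyLattice
open Summit.NavierStokesRegularity.FluidComputer.AbcClassII
open Summit.NavierStokesRegularity.FluidComputer.AbcClassI (IsClassI)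
open Summit.NavierStokesRegularity.FluidComputer.CertificateAbcSpectrum

/-! ### §1 The generic comparison and the numeric order of the two enclosures -/

/-- **Exactly-one (class II) + the class-I abscissa ⇒ contest.** If every classical class-II eigenvalue with
`Re z ≥ a` equals `λ_II`, `|λ_II − ℓ_II| ≤ ρ_II`, `a ≤ ℓ_II − ρ_II`, `ℓ_II + ρ_II < ℓ_I − ρ_I ≤ Re λ_I`, then EVERY
classical class-II eigenpair `(z, u)` has `Re z < Re λ_I`. -/
theorem contest_of_exactly_one_of_pair {ν a ℓII ρII ℓI ρI : ℝ} (hord : ℓII + ρII < ℓI - ρI) (ha : a ≤ ℓII - ρII)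
    (lamII : ℂ) (hclose : ‖lamII - ((ℓII : ℝ) : ℂ)‖ ≤ ρII)
    (huniq : ∀ (z : ℂ) (u : UnitAddTorus (Fin 3) → EuclideanSpace ℂ (Fin 3)),
      Torus.LinNSResolventRel ν (Torus.abcFlow 1 1 1) (2 * Real.pi * z) u 0 → u ≠ 0 →
        IsClassII (mFourierCoeff u) → a ≤ z.re → z = lamII)
    (lamI : ℂ) (hreloI : ℓI - ρI ≤ lamI.re) :
    ∀ (z : ℂ) (u : UnitAddTorus (Fin 3) → EuclideanSpace ℂ (Fin 3)),
      Torus.LinNSResolventRel ν (Torus.abcFlow 1 1 1) (2 * Real.pi * z) u 0 → u ≠ 0 →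
        IsClassII (mFourierCoeff u) → z.re < lamI.re := by
  intro z u hu hu0 huII
  have hρ : 0 ≤ ρII := (norm_nonneg _).trans hclose
  have hII : lamII.re ≤ ℓII + ρII := by
    have h1 : |(lamII - ((ℓII : ℝ) : ℂ)).re| ≤ ‖lamII - ((ℓII : ℝ) : ℂ)‖ := Complex.abs_re_le_norm _
    rw [Complex.sub_re, Complex.ofReal_re] at h1
    have h3 := (abs_le.mp (h1.trans hclose)).2
    linarith
  by_cases hz : a ≤ z.re
  · have := huniq z u hu hu0 huII hz
    subst this
    linarith
  · push Not at hz
    linarith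

/-- The two enclosures of record are ORDERED: `Row3002C.lamRe + Row3002C.rho < Row3001C.lamRe − Row3001C.rho`
(`0.26171… + 5.1·10⁻¹² < 0.26419… − 7.5·10⁻¹²`; margin `0.0024804…`). -/
theorem row3002C_add_rho_lt_row3001C_sub_rho :
    ((Row3002C.lamRe : ℚ) : ℝ) + ((Row3002C.rho : ℚ) : ℝ) < ((Row3001C.lamRe : ℚ) : ℝ) - ((Row3001C.rho : ℚ) : ℝ) := by
  have h : Row3002C.lamRe + Row3002C.rho < Row3001C.lamRe - Row3001C.rho := by
    norm_num [Row3002C.lamRe, Row3002C.rho, Row3001C.lamRe, Row3001C.rho]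
  have h' : ((Row3002C.lamRe + Row3002C.rho : ℚ) : ℝ) < ((Row3001C.lamRe - Row3001C.rho : ℚ) : ℝ) := by
    exact_mod_cast h
  push_cast at h'
  linarith

/-- The contest margin of record: `Row3001C.lamRe − Row3001C.rho − (Row3002C.lamRe + Row3002C.rho) ≥ 0.0024804`. -/
theorem contest_margin_R300 :
    (24804 / 10000000 : ℝ) ≤ ((Row3001C.lamRe : ℚ) : ℝ) - ((Row3001C.rho : ℚ) : ℝ) -
      (((Row3002C.lamRe : ℚ) : ℝ) + ((Row3002C.rho : ℚ) : ℝ)) := by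
  have h : (24804 / 10000000 : ℚ) ≤ Row3001C.lamRe - Row3001C.rho - (Row3002C.lamRe + Row3002C.rho) := by
    norm_num [Row3002C.lamRe, Row3002C.rho, Row3001C.lamRe, Row3001C.rho]
  have h' : ((24804 / 10000000 : ℚ) : ℝ) ≤
      ((Row3001C.lamRe - Row3001C.rho - (Row3002C.lamRe + Row3002C.rho) : ℚ) : ℝ) := by exact_mod_cast h
  push_cast at h'
  linarith

/-! ### §2 The END-TO-END sentences (R 300, classes I vs II) -/

section Rows

variable (wf : Idx → Fam)
variable (hws : ∀ i : Idx, ∀ k ∉ i.1.1, wf i k = 0)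
variable (hwt : ∀ (i : Idx) (k : Fin 3 → ℤ), ∑ j : Fin 3, ((k j : ℤ) : ℂ) * wf i k j = 0)
variable (hwII : ∀ i : Idx, IsClassII (wf i))
variable (hwon : ∀ (O : Orbit) (a b : Fin (odim O)),
  ∑ k ∈ O.1, (inner ℂ (wf ⟨O, a⟩ k) (wf ⟨O, b⟩ k) : ℂ) = if a = b then 1 else 0)
variable (amc : Idx → Idx → ℂ)
variable (hamc : ∀ i j : Idx, amc i j =
  ∑ k ∈ i.1.1, (inner ℂ (wf i k) (Torus.lerayCoeff k (crossForm 1 1 1 (wf j) k)) : ℂ))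
variable (e : ∀ O : Orbit, OrthonormalBasis (Fin (odim O)) ℝ (realSpace O.1))
variable (bf : Idx → Fam)
variable (hbf : ∀ i : Idx, bf i = extend i.1.1 ((e i.1 i.2 : realSpace i.1.1) : EuclideanSpace ℂ (↥i.1.1 × Fin 3)))
variable (am : Idx → Idx → ℝ)
variable (ham : ∀ i j : Idx, am i j =
  (∑ k ∈ i.1.1, (inner ℂ (bf i k) (Torus.lerayCoeff k (crossForm 1 1 1 (bf j) k)) : ℂ)).re)
variable (wfI : AbcClassI.Idx → Fam)
variable (hwsI : ∀ i : AbcClassI.Idx, ∀ k ∉ i.1.1, wfI i k = 0)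
variable (hwtI : ∀ (i : AbcClassI.Idx) (k : Fin 3 → ℤ), ∑ j : Fin 3, ((k j : ℤ) : ℂ) * wfI i k j = 0)
variable (hwI : ∀ i : AbcClassI.Idx, IsClassI (wfI i))
variable (hwonI : ∀ (O : Orbit) (a b : Fin (AbcClassI.odim O)),
  ∑ k ∈ O.1, (inner ℂ (wfI ⟨O, a⟩ k) (wfI ⟨O, b⟩ k) : ℂ) = if a = b then 1 else 0)
variable (amcI : AbcClassI.Idx → AbcClassI.Idx → ℂ)
variable (hamcI : ∀ i j : AbcClassI.Idx, amcI i j =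
  ∑ k ∈ i.1.1, (inner ℂ (wfI i k) (Torus.lerayCoeff k (crossForm 1 1 1 (wfI j) k)) : ℂ))

include hws hwt hwII hwon hamc hbf ham hwsI hwtI hwI hwonI hamcI in
/-- **CONTEST-I AT R = 300 AS ONE KERNEL SENTENCE — IMPLEMENTATION 1's INERTIA cells (class II (28, 30) j269623, class I (26, 28) j269622).** HYPOTHESES (four script-certified finite-matrix
fact families, each VERBATIM as in the file that consumes it): the T1 row `Row3002C` (class II, implementation C,
complex orbit bases `wf`: `AbcClassIIEigenpairRow3002CClassical`); the INERTIA-3L class-II cell `(300, II, 1/5, 1;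
28, 30)` in the real orthonormal orbit bases `e` (`AbcInertiaExactlyOneTight.R300II_exactly_one_tight_i3`); the
T2 row `Row3001C` (class I, implementation C, complex orbit bases `wfI`: `AbcClassIEigenpairRow3001CClassical`); the
INERTIA-3L class-I cell `(300, I, 43/200, 2; 26, 28)` on `AbcClassI.amat` (`AbcInertiaCIExactlyPair.R300I_exactly_pair_i3`).
CONCLUSION: the class-II leader `λ_II` (real, `|λ_II − 0.2617112…| ≤ 5.1·10⁻¹²`, a classical class-II eigenfunction,
ALL of `σ_p(L|II) ∩ {Re ≥ 1/5}`), the class-I Hopf pair `λ_I, conj λ_I` (`|λ_I − (0.2641917… + 0.6430289… i)| ≤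
7.5·10⁻¹²`, `Im λ_I > 0`, classical class-I eigenfunctions, ALL of `σ_p(L|I) ∩ {Re ≥ 43/200}`), `λ_II < Re λ_I`, and
**every classical class-II eigenpair `(z, u)` has `Re z < Re λ_I`** — the class-I Hopf pair LEADS the whole class-II
point spectrum (contest-I, T6). MODEL; conditional on the four certifier audits and AUDIT-BASIS; classes III–V untreated. -/
theorem contestI_R300_i3
    (vt : Idx → ℂ) (hvt0 : ∀ i, i ∉ cubeIdx 96 → vt i = 0)
    (hres : ∑ i ∈ cubeIdx 96 ∪ (cubeIdx 96).biUnion nbrIdx,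
      ‖(if i ∈ cubeIdx 96 then ((((Row3002C.lamRe : ℚ) : ℝ) : ℂ) - ((-(onormSq i.1 / 300) : ℝ) : ℂ)) * vt i
          else 0) - ∑ j ∈ cubeIdx 96, amc i j * vt j‖ ^ 2 ≤ ((Row3002C.rnorm : ℚ) : ℝ) ^ 2)
    (hntb : ∑ i ∈ cubeIdx 96 \ cubeIdx 22, ‖vt i‖ ^ 2 ≤
      (((5848008621608657 : ℚ) / 576460752303423488 : ℚ) : ℝ) ^ 2)
    (Binv : ((↥(cubeIdx 22) → ℂ) × ℂ) →ₗ[ℂ] ((↥(cubeIdx 22) → ℂ) × ℂ))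
    (hBinv : ∀ (c : ↥(cubeIdx 22) → ℂ) (m : ℂ),
      Binv (fun i : ↥(cubeIdx 22) =>
          ((((Row3002C.lamRe : ℚ) : ℝ) : ℂ) - ((-(onormSq i.1.1 / 300) : ℝ) : ℂ)) * c i -
          ∑ j : ↥(cubeIdx 22), amc i j * c j + m * vt i,
        ∑ i : ↥(cubeIdx 22), conj (vt i) * c i) = (c, m))
    (hαM : ∀ (c : ↥(cubeIdx 22) → ℂ) (g : ℂ),
      ∑ j : ↥(cubeIdx 22), ‖(Binv (c, g)).1 j‖ ^ 2 + ‖(Binv (c, g)).2‖ ^ 2 ≤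
        ((Row3002C.alpha0 : ℚ) : ℝ) ^ 2 * (∑ i : ↥(cubeIdx 22), ‖c i‖ ^ 2 + ‖g‖ ^ 2))
    (hβBM : ∀ w : Idx → ℂ,
      ∑ j : ↥(cubeIdx 22), ‖(Binv (fun i : ↥(cubeIdx 22) => -∑ j ∈ nbrIdx i \ cubeIdx 22,
          amc i j * w j, 0)).1 j‖ ^ 2 +
        ‖(Binv (fun i : ↥(cubeIdx 22) => -∑ j ∈ nbrIdx i \ cubeIdx 22,
          amc i j * w j, 0)).2‖ ^ 2 ≤
        ((Row3002C.betaB : ℚ) : ℝ) ^ 2 * ∑ j ∈ (cubeIdx 22).biUnion nbrIdx \ cubeIdx 22, ‖w j‖ ^ 2)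
    (hβCM : ∀ (c : ↥(cubeIdx 22) → ℂ) (g : ℂ),
      ∑ i ∈ ((cubeIdx 22).biUnion nbrIdx ∪ cubeIdx 96) \ cubeIdx 22,
        ‖-∑ j : ↥(cubeIdx 22), amc i j * (Binv (c, g)).1 j +
          (Binv (c, g)).2 * vt i‖ ^ 2 ≤
        ((Row3002C.betaC : ℚ) : ℝ) ^ 2 * (∑ i : ↥(cubeIdx 22), ‖c i‖ ^ 2 + ‖g‖ ^ 2))
    (hgBM : ∀ w : Idx → ℂ,
      ‖(Binv (fun i : ↥(cubeIdx 22) => ∑ j ∈ nbrIdx i \ cubeIdx 22,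
          amc i j * w j, 0)).2‖ ^ 2 ≤
        (((959475027496217 : ℚ) / 281474976710656 : ℚ) : ℝ) ^ 2 *
          ∑ j ∈ (cubeIdx 22).biUnion nbrIdx \ cubeIdx 22, ‖w j‖ ^ 2)
    (hshellM : ∀ w : Idx → ℂ, (∀ i ∈ cubeIdx 22, w i = 0) →
      (((5501868957119981 : ℚ) / 9007199254740992 : ℚ) : ℝ) * ∑ i ∈ cubeIdx (22 + 1) \ cubeIdx 22, ‖w i‖ ^ 2 ≤
        ∑ i ∈ cubeIdx (22 + 1) \ cubeIdx 22,
          ((((Row3002C.lamRe : ℚ) : ℝ) : ℂ).re - (-(onormSq i.1 / 300)) - Real.sqrt 2) * ‖w i‖ ^ 2 -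
        RCLike.re (∑ i ∈ (cubeIdx 22).biUnion nbrIdx \ cubeIdx 22,
          conj (∑ j : ↥(cubeIdx 22), amc i j *
            (Binv (fun i : ↥(cubeIdx 22) => ∑ j ∈ nbrIdx i \ cubeIdx 22,
              amc i j * w j, 0)).1 j) * w i))
    {HL HH HB : Finset Idx}
    (hHL : ∀ i : Idx, i ∈ HL ↔ onormSq i.1 ≤ (28 : ℝ) ^ 2)
    (hHH : ∀ i : Idx, i ∈ HH ↔ onormSq i.1 ≤ (30 : ℝ) ^ 2)
    (hHB : ∀ i : Idx, i ∈ HB ↔ (30 : ℝ) ^ 2 < onormSq i.1 ∧ onormSq i.1 ≤ ((30 : ℝ) + 1) ^ 2)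
    (GH' Ah' : Matrix ↥HH ↥HH ℝ) (AHB' : Matrix ↥HH ↥HB ℝ) (ABH' : Matrix ↥HB ↥HH ℝ) (E : ↥HB → ℝ)
    (V' : Matrix ↥HH (Fin 1) ℝ) (hGH' : GH'ᵀ = GH')
    (hAh' : Ah' = Matrix.of fun i j : ↥HH =>
      (if i = j then -(onormSq i.1.1 / (300 : ℝ)) - (1 / 5 : ℝ) else 0) + am i.1 j.1)
    (hAHB' : AHB' = Matrix.of fun (i : ↥HH) (l : ↥HB) => am i.1 l.1)
    (hABH' : ABH' = Matrix.of fun (l : ↥HB) (i : ↥HH) => am l.1 i.1)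
    (hE : E = fun l : ↥HB => onormSq l.1.1 / (300 : ℝ) + (1 / 5 : ℝ) - Real.sqrt 2)
    (hR1' : ∀ x : ↥HH → ℝ, x ≠ 0 →
      x ⬝ᵥ ((GH' * Ah' + Ah'ᵀ * GH' + (1 / 2 : ℝ) • ((GH' * AHB' + ABH'ᵀ) * Matrix.diagonal (fun l => (E l)⁻¹) *
        (GH' * AHB' + ABH'ᵀ)ᵀ)) *ᵥ x) < 0)
    (hR2' : ∀ x : ↥HH → ℝ, 0 ≤ x ⬝ᵥ ((GH' + V' * V'ᵀ) *ᵥ x))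
    (vtI : AbcClassI.Idx → ℂ) (hvt0I : ∀ i, i ∉ AbcClassI.cubeIdx 96 → vtI i = 0)
    (hresI : ∑ i ∈ AbcClassI.cubeIdx 96 ∪ (AbcClassI.cubeIdx 96).biUnion AbcClassI.nbrIdx,
      ‖(if i ∈ AbcClassI.cubeIdx 96 then (((((Row3001C.lamRe : ℚ) : ℝ) : ℂ) + (((Row3001C.lamIm : ℚ) : ℝ) : ℂ) * Complex.I) - ((-(onormSq i.1 / 300) : ℝ) : ℂ)) * vtI i
          else 0) - ∑ j ∈ AbcClassI.cubeIdx 96, amcI i j * vtI j‖ ^ 2 ≤ ((Row3001C.rnorm : ℚ) : ℝ) ^ 2)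
    (hntbI : ∑ i ∈ AbcClassI.cubeIdx 96 \ AbcClassI.cubeIdx 22, ‖vtI i‖ ^ 2 ≤
      (((2315674124931519 : ℚ) / 288230376151711744 : ℚ) : ℝ) ^ 2)
    (BinvI : ((↥(AbcClassI.cubeIdx 22) → ℂ) × ℂ) →ₗ[ℂ] ((↥(AbcClassI.cubeIdx 22) → ℂ) × ℂ))
    (hBinvI : ∀ (c : ↥(AbcClassI.cubeIdx 22) → ℂ) (m : ℂ),
      BinvI (fun i : ↥(AbcClassI.cubeIdx 22) =>
          (((((Row3001C.lamRe : ℚ) : ℝ) : ℂ) + (((Row3001C.lamIm : ℚ) : ℝ) : ℂ) * Complex.I) - ((-(onormSq i.1.1 / 300) : ℝ) : ℂ)) * c i -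
          ∑ j : ↥(AbcClassI.cubeIdx 22), amcI i j * c j + m * vtI i,
        ∑ i : ↥(AbcClassI.cubeIdx 22), conj (vtI i) * c i) = (c, m))
    (hαMI : ∀ (c : ↥(AbcClassI.cubeIdx 22) → ℂ) (g : ℂ),
      ∑ j : ↥(AbcClassI.cubeIdx 22), ‖(BinvI (c, g)).1 j‖ ^ 2 + ‖(BinvI (c, g)).2‖ ^ 2 ≤
        ((Row3001C.alpha0 : ℚ) : ℝ) ^ 2 * (∑ i : ↥(AbcClassI.cubeIdx 22), ‖c i‖ ^ 2 + ‖g‖ ^ 2))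
    (hβBMI : ∀ w : AbcClassI.Idx → ℂ,
      ∑ j : ↥(AbcClassI.cubeIdx 22), ‖(BinvI (fun i : ↥(AbcClassI.cubeIdx 22) => -∑ j ∈ AbcClassI.nbrIdx i \ AbcClassI.cubeIdx 22,
          amcI i j * w j, 0)).1 j‖ ^ 2 +
        ‖(BinvI (fun i : ↥(AbcClassI.cubeIdx 22) => -∑ j ∈ AbcClassI.nbrIdx i \ AbcClassI.cubeIdx 22,
          amcI i j * w j, 0)).2‖ ^ 2 ≤
        ((Row3001C.betaB : ℚ) : ℝ) ^ 2 * ∑ j ∈ (AbcClassI.cubeIdx 22).biUnion AbcClassI.nbrIdx \ AbcClassI.cubeIdx 22, ‖w j‖ ^ 2)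
    (hβCMI : ∀ (c : ↥(AbcClassI.cubeIdx 22) → ℂ) (g : ℂ),
      ∑ i ∈ ((AbcClassI.cubeIdx 22).biUnion AbcClassI.nbrIdx ∪ AbcClassI.cubeIdx 96) \ AbcClassI.cubeIdx 22,
        ‖-∑ j : ↥(AbcClassI.cubeIdx 22), amcI i j * (BinvI (c, g)).1 j +
          (BinvI (c, g)).2 * vtI i‖ ^ 2 ≤
        ((Row3001C.betaC : ℚ) : ℝ) ^ 2 * (∑ i : ↥(AbcClassI.cubeIdx 22), ‖c i‖ ^ 2 + ‖g‖ ^ 2))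
    (hgBMI : ∀ w : AbcClassI.Idx → ℂ,
      ‖(BinvI (fun i : ↥(AbcClassI.cubeIdx 22) => ∑ j ∈ AbcClassI.nbrIdx i \ AbcClassI.cubeIdx 22,
          amcI i j * w j, 0)).2‖ ^ 2 ≤
        (((2617195581838679 : ℚ) / 2251799813685248 : ℚ) : ℝ) ^ 2 *
          ∑ j ∈ (AbcClassI.cubeIdx 22).biUnion AbcClassI.nbrIdx \ AbcClassI.cubeIdx 22, ‖w j‖ ^ 2)
    (hshellMI : ∀ w : AbcClassI.Idx → ℂ, (∀ i ∈ AbcClassI.cubeIdx 22, w i = 0) →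
      (((5524214073445137 : ℚ) / 9007199254740992 : ℚ) : ℝ) * ∑ i ∈ AbcClassI.cubeIdx (22 + 1) \ AbcClassI.cubeIdx 22, ‖w i‖ ^ 2 ≤
        ∑ i ∈ AbcClassI.cubeIdx (22 + 1) \ AbcClassI.cubeIdx 22,
          (((((Row3001C.lamRe : ℚ) : ℝ) : ℂ) + (((Row3001C.lamIm : ℚ) : ℝ) : ℂ) * Complex.I).re - (-(onormSq i.1 / 300)) - Real.sqrt 2) * ‖w i‖ ^ 2 -
        RCLike.re (∑ i ∈ (AbcClassI.cubeIdx 22).biUnion AbcClassI.nbrIdx \ AbcClassI.cubeIdx 22,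
          conj (∑ j : ↥(AbcClassI.cubeIdx 22), amcI i j *
            (BinvI (fun i : ↥(AbcClassI.cubeIdx 22) => ∑ j ∈ AbcClassI.nbrIdx i \ AbcClassI.cubeIdx 22,
              amcI i j * w j, 0)).1 j) * w i))
    {HLI HHI HBI : Finset AbcClassI.Idx}
    (hHLI : ∀ i : AbcClassI.Idx, i ∈ HLI ↔ onormSq i.1 ≤ (26 : ℝ) ^ 2)
    (hHHI : ∀ i : AbcClassI.Idx, i ∈ HHI ↔ onormSq i.1 ≤ (28 : ℝ) ^ 2)
    (hHBI : ∀ i : AbcClassI.Idx, i ∈ HBI ↔ (28 : ℝ) ^ 2 < onormSq i.1 ∧ onormSq i.1 ≤ ((28 : ℝ) + 1) ^ 2)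
    (GHI AhI : Matrix ↥HHI ↥HHI ℝ) (AHBI : Matrix ↥HHI ↥HBI ℝ) (ABHI : Matrix ↥HBI ↥HHI ℝ) (EI : ↥HBI → ℝ)
    (VI : Matrix ↥HHI (Fin 2) ℝ) (hGHI : GHIᵀ = GHI)
    (hAhI : AhI = Matrix.of fun i j : ↥HHI =>
      (if i = j then -(onormSq i.1.1 / (300 : ℝ)) - (43 / 200 : ℝ) else 0) + AbcClassI.amat i.1 j.1)
    (hAHBI : AHBI = Matrix.of fun (i : ↥HHI) (l : ↥HBI) => AbcClassI.amat i.1 l.1)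
    (hABHI : ABHI = Matrix.of fun (l : ↥HBI) (i : ↥HHI) => AbcClassI.amat l.1 i.1)
    (hEI : EI = fun l : ↥HBI => onormSq l.1.1 / (300 : ℝ) + (43 / 200 : ℝ) - Real.sqrt 2)
    (hR1I : ∀ x : ↥HHI → ℝ, x ≠ 0 →
      x ⬝ᵥ ((GHI * AhI + AhIᵀ * GHI + (1 / 2 : ℝ) • ((GHI * AHBI + ABHIᵀ) * Matrix.diagonal (fun l => (EI l)⁻¹) *
        (GHI * AHBI + ABHIᵀ)ᵀ)) *ᵥ x) < 0)
    (hR2I : ∀ x : ↥HHI → ℝ, 0 ≤ x ⬝ᵥ ((GHI + VI * VIᵀ) *ᵥ x)) :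
    ∃ lamII lamI : ℂ,
      ‖lamII - (((Row3002C.lamRe : ℚ) : ℝ) : ℂ)‖ ≤ ((Row3002C.rho : ℚ) : ℝ) ∧ lamII.im = 0 ∧
      ‖lamI - ((((Row3001C.lamRe : ℚ) : ℝ) : ℂ) + (((Row3001C.lamIm : ℚ) : ℝ) : ℂ) * Complex.I)‖ ≤
        ((Row3001C.rho : ℚ) : ℝ) ∧ 0 < lamI.im ∧ lamII.re < lamI.re ∧
      (∃ u : UnitAddTorus (Fin 3) → EuclideanSpace ℂ (Fin 3),
        Torus.LinNSResolventRel (1 / (2 * Real.pi * 300)) (Torus.abcFlow 1 1 1) (2 * Real.pi * lamII) u 0 ∧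
          u ≠ 0 ∧ IsClassII (mFourierCoeff u)) ∧
      (∃ u : UnitAddTorus (Fin 3) → EuclideanSpace ℂ (Fin 3),
        Torus.LinNSResolventRel (1 / (2 * Real.pi * 300)) (Torus.abcFlow 1 1 1) (2 * Real.pi * lamI) u 0 ∧
          u ≠ 0 ∧ IsClassI (mFourierCoeff u)) ∧
      (∃ u : UnitAddTorus (Fin 3) → EuclideanSpace ℂ (Fin 3),
        Torus.LinNSResolventRel (1 / (2 * Real.pi * 300)) (Torus.abcFlow 1 1 1) (2 * Real.pi * conj lamI) u 0 ∧
          u ≠ 0 ∧ IsClassI (mFourierCoeff u)) ∧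
      (∀ (z : ℂ) (u : UnitAddTorus (Fin 3) → EuclideanSpace ℂ (Fin 3)),
        Torus.LinNSResolventRel (1 / (2 * Real.pi * 300)) (Torus.abcFlow 1 1 1) (2 * Real.pi * z) u 0 → u ≠ 0 →
          IsClassII (mFourierCoeff u) → (1 / 5 : ℝ) ≤ z.re → z = lamII) ∧
      (∀ (z : ℂ) (u : UnitAddTorus (Fin 3) → EuclideanSpace ℂ (Fin 3)),
        Torus.LinNSResolventRel (1 / (2 * Real.pi * 300)) (Torus.abcFlow 1 1 1) (2 * Real.pi * z) u 0 → u ≠ 0 →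
          IsClassI (mFourierCoeff u) → (43 / 200 : ℝ) ≤ z.re → z = lamI ∨ z = conj lamI) ∧
      ∀ (z : ℂ) (u : UnitAddTorus (Fin 3) → EuclideanSpace ℂ (Fin 3)),
        Torus.LinNSResolventRel (1 / (2 * Real.pi * 300)) (Torus.abcFlow 1 1 1) (2 * Real.pi * z) u 0 → u ≠ 0 →
          IsClassII (mFourierCoeff u) → z.re < lamI.re := by
  obtain ⟨lamII, hcloseII, himII, hreloII, honeII, huniqII⟩ :=
    AbcInertia.R300II_exactly_one_tight_i3 wf hws hwt hwII hwon amc hamc e bf hbf am ham vt hvt0 hres hntb Binv hBinv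
      hαM hβBM hβCM hgBM hshellM hHL hHH hHB GH' Ah' AHB' ABH' E V' hGH' hAh' hAHB' hABH' hE hR1' hR2'
  obtain ⟨lamI, hcloseI, hreloI, himI, hpairI, hpaircI, huniqI⟩ :=
    AbcInertiaCI.R300I_exactly_pair_i3 wfI hwsI hwtI hwI hwonI amcI hamcI vtI hvt0I hresI hntbI BinvI hBinvI
      hαMI hβBMI hβCMI hgBMI hshellMI hHLI hHHI hHBI GHI AhI AHBI ABHI EI VI hGHI hAhI hAHBI hABHI hEI hR1I hR2I
  have hcon := contest_of_exactly_one_of_pair (ν := 1 / (2 * Real.pi * 300)) row3002C_add_rho_lt_row3001C_sub_rho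
    AbcInertia.a_le_row3002C lamII hcloseII huniqII lamI hreloI
  obtain ⟨uII, huII, huII0, huIIcl⟩ := honeII
  exact ⟨lamII, lamI, hcloseII, himII, hcloseI, himI, hcon lamII uII huII huII0 huIIcl, ⟨uII, huII, huII0, huIIcl⟩,
    hpairI, hpaircI, huniqII, huniqI, hcon⟩

end Rows

end Summit.NavierStokesRegularity.FluidComputer.AbcContestI

end
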